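import Summits.RiemannHypothesis.RiemannHypothesis.Theorems.WeilColumnBSplineCDF
import Literature.NumberTheory.LFunctions.FordZetaBoundKappa12
import HarnessLib

/-!
# THETA kernel certificate, analytic layer D8: the GAIN — the lower Riemann sum `I_lo(J) ≤ I_top` (RH-FREE)

Cell `rh-explicit`, WEIL column, seat handoff-prove-2 gen12 (THETA-ASSIGN v1.0 §3 D8; interface `WeilColumnThetaWitness`, p418783).
For `P : ThetaParams` with `0 < δ` and `2 ≤ m`, and every `J ≥ 1`:

  **`P.Ilo J ≤ P.Itop`** (`ThetaParams.Ilo_le_Itop`),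

i.e. the checker's `gain = 2 log q · I_lo(J)` is a lower bound of `2 log q · I_top`, `I_top = ∫₀^{2δ} R(τ₁ w)R(τ₁(2δ−w))dw`
(`= V_g(log q)/√q`, D4).  THETA-CERT-cc6 §D8 verbatim: `R = P.Rtop` is increasing and `≥ 0` (W1: `bsplineCDF` monotone, `≤ 1`),
`τ₁` is increasing, the integrand is symmetric under `w ↦ 2δ − w` (so `I_top = 2∫₀^δ`), on `[w_j, w_{j+1}]` each factor is bounded
below by its value at the unfavourable endpoint, and `τ₁(w) = (1 − e^{−w})/(2δ) ≥ (w − w²/2)/(2δ)` for `w ≥ 0`.  Nothing here bears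
on the truth of RH.
-/

noncomputable section

set_option linter.dupNamespace false

open Set MeasureTheory Filter Finset
open scoped Real Topology

namespace Summit.RiemannHypothesis.RiemannHypothesis.Theorems.WeilColumn.ThetaMellin

open Literature.NumberTheory.LFunctions

/-! ## §1 (`e^{−w} ≤ 1 − w + w²/2` for `w ≥ 0` is the tree's `FordVK.exp_neg_le_taylor2`) -/

namespace ThetaParams

variable (P : ThetaParams)

/-! ## §2 The top-layer profile `R = P.Rtop` and the map `τ₁` -/

/-- `R` is monotone (nondecreasing) — `bsplineCDF` is. -/
theorem Rtop_mono (hm : 1 ≤ P.m) : Monotone P.Rtop := by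
  intro τ τ' h
  unfold Rtop
  have hc : 0 ≤ 1 / (P.m : ℝ) := by positivity
  have := bsplineCDF_mono hc (P.m - 1) (show 1 - τ' ≤ 1 - τ by linarith)
  linarith

/-- `0 ≤ R` — `bsplineCDF ≤ 1`. -/
theorem Rtop_nonneg (hm : 1 ≤ P.m) (τ : ℝ) : 0 ≤ P.Rtop τ := by
  unfold Rtop
  have hm0 : (0 : ℝ) < P.m := Nat.cast_pos.2 (by omega)
  have hc : 0 < 1 / (P.m : ℝ) := by positivity
  linarith [bsplineCDF_le_one hc (P.m - 1) (1 - τ)]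

/-- `R` is continuous for `m ≥ 2`. -/
theorem continuous_Rtop (hm : 2 ≤ P.m) : Continuous P.Rtop := by
  have hm0 : (0 : ℝ) < P.m := Nat.cast_pos.2 (by omega)
  have hc : 0 < 1 / (P.m : ℝ) := by positivity
  have h := continuous_bsplineCDF hc (k := P.m - 1) (by omega)
  unfold Rtop
  exact continuous_const.sub (h.comp (continuous_const.sub continuous_id))

/-- `τ₁` is monotone for `δ > 0`. -/
theorem τ₁_mono (hδ : 0 < P.δ) : Monotone P.τ₁ := by
  intro w w' h
  unfold τ₁
  refine div_le_div_of_nonneg_right ?_ (by positivity)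
  linarith [Real.exp_le_exp.2 (neg_le_neg h)]

/-- `τ₁` is continuous. -/
theorem continuous_τ₁ : Continuous P.τ₁ := by
  unfold τ₁; fun_prop

/-- `τ₁(w) ≥ (w − w²/2)/(2δ)` for `w ≥ 0`, `δ > 0`. -/
theorem quad_le_τ₁ (hδ : 0 < P.δ) {w : ℝ} (hw : 0 ≤ w) : (w - w ^ 2 / 2) / (2 * P.δ) ≤ P.τ₁ w := by
  unfold τ₁
  refine div_le_div_of_nonneg_right ?_ (by positivity)
  linarith [FordVK.exp_neg_le_taylor2 hw]

/-! ## §3 `I_lo(J) ≤ I_top` -/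

/-- The integrand `f(w) = R(τ₁ w)·R(τ₁(2δ − w))`, continuous for `m ≥ 2`. -/
theorem continuous_topIntegrand (hm : 2 ≤ P.m) :
    Continuous fun w ↦ P.Rtop (P.τ₁ w) * P.Rtop (P.τ₁ (2 * P.δ - w)) :=
  ((P.continuous_Rtop hm).comp P.continuous_τ₁).mul
    ((P.continuous_Rtop hm).comp (P.continuous_τ₁.comp (continuous_const.sub continuous_id)))

/-- Symmetry: `I_top = 2 ∫₀^δ R(τ₁ w)R(τ₁(2δ − w)) dw`. -/
theorem Itop_eq_two_mul (hm : 2 ≤ P.m) :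
    P.Itop = 2 * ∫ w in (0 : ℝ)..P.δ, P.Rtop (P.τ₁ w) * P.Rtop (P.τ₁ (2 * P.δ - w)) := by
  set f : ℝ → ℝ := fun w ↦ P.Rtop (P.τ₁ w) * P.Rtop (P.τ₁ (2 * P.δ - w)) with hf
  have hcont : Continuous f := P.continuous_topIntegrand hm
  have hsplit : ∫ w in (0 : ℝ)..(2 * P.δ), f w = (∫ w in (0 : ℝ)..P.δ, f w) + ∫ w in P.δ..(2 * P.δ), f w :=
    (intervalIntegral.integral_add_adjacent_intervals (hcont.intervalIntegrable _ _) (hcont.intervalIntegrable _ _)).symm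
  have hsymm : ∫ w in P.δ..(2 * P.δ), f w = ∫ w in (0 : ℝ)..P.δ, f w := by
    have h := intervalIntegral.integral_comp_sub_left f (2 * P.δ) (a := 0) (b := P.δ)
    rw [show 2 * P.δ - P.δ = P.δ by ring, sub_zero] at h
    rw [← h]
    refine intervalIntegral.integral_congr fun w _ ↦ ?_
    simp only [hf]
    rw [show 2 * P.δ - (2 * P.δ - w) = w by ring, mul_comm]
  unfold Itop
  rw [hsplit, hsymm]
  ring

/-- **D8: `I_lo(J) ≤ I_top`** for `δ > 0`, `m ≥ 2`, `J ≥ 1`. [THETA-CERT-cc6 §D8] -/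
theorem Ilo_le_Itop (hδ : 0 < P.δ) (hm : 2 ≤ P.m) {J : ℕ} (hJ : 0 < J) : P.Ilo J ≤ P.Itop := by
  have hm1 : 1 ≤ P.m := by omega
  set f : ℝ → ℝ := fun w ↦ P.Rtop (P.τ₁ w) * P.Rtop (P.τ₁ (2 * P.δ - w)) with hf
  have hcont : Continuous f := P.continuous_topIntegrand hm
  have hJ0 : (0 : ℝ) < J := by exact_mod_cast hJ
  -- the partition `w_j = δ j / J`
  set a : ℕ → ℝ := fun j ↦ P.δ * j / J with ha
  have ha0 : a 0 = 0 := by simp [ha]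
  have haJ : a J = P.δ := by simp [ha]; field_simp
  have hstep : ∀ j : ℕ, a (j + 1) - a j = P.δ / J := by intro j; simp [ha]; field_simp; ring
  have hsum : ∑ j ∈ Finset.range J, ∫ w in a j..a (j + 1), f w = ∫ w in (0 : ℝ)..P.δ, f w := by
    rw [intervalIntegral.sum_integral_adjacent_intervals (fun j _ ↦ hcont.intervalIntegrable _ _), ha0, haJ]
  -- each cell
  have hcell : ∀ j ∈ Finset.range J,
      P.δ / J * P.Rtop (((P.δ * j / J) - (P.δ * j / J) ^ 2 / 2) / (2 * P.δ)) *
          P.Rtop (((2 * P.δ - P.δ * (j + 1) / J) - (2 * P.δ - P.δ * (j + 1) / J) ^ 2 / 2) / (2 * P.δ)) ≤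
        ∫ w in a j..a (j + 1), f w := by
    intro j hj
    have hjJ : (j : ℝ) + 1 ≤ J := by exact_mod_cast Finset.mem_range.1 hj
    have hle : a j ≤ a (j + 1) := by
      have h1 := hstep j
      have h2 : 0 < P.δ / J := by positivity
      linarith
    set wj : ℝ := P.δ * j / J with hwj
    set sj : ℝ := 2 * P.δ - P.δ * (j + 1) / J with hsj
    have hwj0 : 0 ≤ wj := by positivity
    have hsj0 : 0 ≤ sj := by
      rw [hsj]
      have : P.δ * ((j : ℝ) + 1) / J ≤ P.δ := by
        rw [div_le_iff₀ hJ0]; nlinarith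
      linarith
    -- the lower constant
    set A := P.Rtop ((wj - wj ^ 2 / 2) / (2 * P.δ)) with hA
    set B := P.Rtop ((sj - sj ^ 2 / 2) / (2 * P.δ)) with hB
    have hA0 : 0 ≤ A := P.Rtop_nonneg hm1 _
    have hB0 : 0 ≤ B := P.Rtop_nonneg hm1 _
    have hA1 : A ≤ P.Rtop (P.τ₁ wj) := P.Rtop_mono hm1 (P.quad_le_τ₁ hδ hwj0)
    have hB1 : B ≤ P.Rtop (P.τ₁ sj) := P.Rtop_mono hm1 (P.quad_le_τ₁ hδ hsj0)
    have hpt : ∀ w ∈ Set.Icc (a j) (a (j + 1)), A * B ≤ f w := by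
      intro w hw
      have hw1 : wj ≤ w := by rw [hwj]; exact hw.1
      have hw2 : sj ≤ 2 * P.δ - w := by
        rw [hsj]; have := hw.2; simp only [ha] at this; push_cast at this; linarith
      have h1 : P.Rtop (P.τ₁ wj) ≤ P.Rtop (P.τ₁ w) := P.Rtop_mono hm1 (P.τ₁_mono hδ hw1)
      have h2 : P.Rtop (P.τ₁ sj) ≤ P.Rtop (P.τ₁ (2 * P.δ - w)) := P.Rtop_mono hm1 (P.τ₁_mono hδ hw2)
      calc A * B ≤ P.Rtop (P.τ₁ wj) * P.Rtop (P.τ₁ sj) := mul_le_mul hA1 hB1 hB0 (P.Rtop_nonneg hm1 _)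
        _ ≤ P.Rtop (P.τ₁ w) * P.Rtop (P.τ₁ (2 * P.δ - w)) :=
            mul_le_mul h1 h2 (P.Rtop_nonneg hm1 _) (P.Rtop_nonneg hm1 _)
    have hmono := intervalIntegral.integral_mono_on hle (intervalIntegrable_const (μ := volume) (c := A * B))
      (hcont.intervalIntegrable _ _) hpt
    rw [intervalIntegral.integral_const, smul_eq_mul, hstep j] at hmono
    calc P.δ / J * A * B = P.δ / J * (A * B) := by ring
      _ ≤ ∫ w in a j..a (j + 1), f w := hmono
  -- assemble
  rw [P.Itop_eq_two_mul hm, ← hsum]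
  unfold Ilo
  refine mul_le_mul_of_nonneg_left (Finset.sum_le_sum hcell) (by norm_num)

/-- **D8 under admissibility**: `P.Ilo J ≤ P.Itop` for every admissible row and `J ≥ 1`. [THETA-CERT-cc6 §D8] -/
theorem Ilo_le_Itop_of_admissible {qn : ℕ} (hP : P.Admissible qn) {J : ℕ} (hJ : 0 < J) : P.Ilo J ≤ P.Itop :=
  P.Ilo_le_Itop hP.delta_pos (le_trans (by norm_num) hP.three_le) hJ

/-- Hence **`gain J ≤ 2 log q · I_top`** (for `q ≥ 1`). [THETA-CERT-cc6 §D8/D9] -/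
theorem gain_le (hδ : 0 < P.δ) (hm : 2 ≤ P.m) {J : ℕ} (hJ : 0 < J) (hq : 1 ≤ P.q) :
    P.gain J ≤ 2 * Real.log P.q * P.Itop := by
  unfold gain
  have hlog : 0 ≤ Real.log P.q := Real.log_nonneg (by exact_mod_cast hq)
  exact mul_le_mul_of_nonneg_left (P.Ilo_le_Itop hδ hm hJ) (by positivity)

end ThetaParams

end Summit.RiemannHypothesis.RiemannHypothesis.Theorems.WeilColumn.ThetaMellin

end
-- 2026-08-26T07:25Z: byte-identical re-land to refresh the stranded hub olean (ops-buildfix recipe); no content change.
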